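import Summits.ValiantsHypothesis.ValiantsHypothesis.Theorems.LacunarySymmetroidMatrixDescartesFiniteSectorKernelTable
import Summits.ValiantsHypothesis.ValiantsHypothesis.Theorems.LacunarySymmetroidMatrixDescartesFiniteSectorSectorCeilingFortyFour
import Summits.ValiantsHypothesis.ValiantsHypothesis.Theorems.LacunarySymmetroidMatrixDescartesFiniteSectorSectorCeilingFourSeven
import Summits.ValiantsHypothesis.ValiantsHypothesis.Theorems.LacunarySymmetroidMatrixDescartesFiniteSectorSectorCeilingFourteenFive
import Summits.ValiantsHypothesis.ValiantsHypothesis.Theorems.LacunarySymmetroidMatrixDescartesFiniteSectorSectorCeilingMTwoKNine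
import Summits.ValiantsHypothesis.ValiantsHypothesis.Theorems.LacunarySymmetroidMatrixDescartesFiniteSectorSectorCeilingSevenSix
import Summits.ValiantsHypothesis.ValiantsHypothesis.Theorems.LacunarySymmetroidMatrixDescartesFiniteSectorSectorCeilingThirteenFive
import Summits.ValiantsHypothesis.ValiantsHypothesis.Theorems.LacunarySymmetroidMatrixDescartesFiniteSectorSectorCeilingThirtyFour
import Summits.ValiantsHypothesis.ValiantsHypothesis.Theorems.LacunarySymmetroidMatrixDescartesFiniteSectorSectorCeilingThirtyeightFour
import Summits.ValiantsHypothesis.ValiantsHypothesis.Theorems.LacunarySymmetroidMatrixDescartesFiniteSectorSectorCeilingThirtyfiveFour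
import Summits.ValiantsHypothesis.ValiantsHypothesis.Theorems.LacunarySymmetroidMatrixDescartesFiniteSectorSectorCeilingThirtyfourFour
import Summits.ValiantsHypothesis.ValiantsHypothesis.Theorems.LacunarySymmetroidMatrixDescartesFiniteSectorSectorCeilingThirtynineFour
import Summits.ValiantsHypothesis.ValiantsHypothesis.Theorems.LacunarySymmetroidMatrixDescartesFiniteSectorSectorCeilingThirtyoneFour
import Summits.ValiantsHypothesis.ValiantsHypothesis.Theorems.LacunarySymmetroidMatrixDescartesFiniteSectorSectorCeilingThirtysevenFour
import Summits.ValiantsHypothesis.ValiantsHypothesis.Theorems.LacunarySymmetroidMatrixDescartesFiniteSectorSectorCeilingThirtysixFour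
import Summits.ValiantsHypothesis.ValiantsHypothesis.Theorems.LacunarySymmetroidMatrixDescartesFiniteSectorSectorCeilingThirtythreeFour
import Summits.ValiantsHypothesis.ValiantsHypothesis.Theorems.LacunarySymmetroidMatrixDescartesFiniteSectorSectorCeilingThirtytwoFour
import Summits.ValiantsHypothesis.ValiantsHypothesis.Theorems.LacunarySymmetroidMatrixDescartesFiniteSectorSectorCeilingThreeEight
import Summits.ValiantsHypothesis.ValiantsHypothesis.Theorems.LacunarySymmetroidMatrixDescartesFiniteSectorSectorCeilingThreeSeven
import Summits.ValiantsHypothesis.ValiantsHypothesis.Theorems.LacunarySymmetroidMatrixDescartesFiniteSectorSectorCeilingTwelveFive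
import Summits.ValiantsHypothesis.ValiantsHypothesis.Theorems.LacunarySymmetroidMatrixDescartesFiniteSectorSectorCeilingTwentyeightFour
import Summits.ValiantsHypothesis.ValiantsHypothesis.Theorems.LacunarySymmetroidMatrixDescartesFiniteSectorSectorCeilingTwentynineFour
import Summits.ValiantsHypothesis.ValiantsHypothesis.Theorems.LacunarySymmetroidMatrixDescartesFiniteSectorSectorCeilingTwentysevenFour
import Summits.ValiantsHypothesis.ValiantsHypothesis.Theorems.LacunarySymmetroidMatrixDescartesFiniteSectorSectorCeilingTwentysixFour
import Summits.ValiantsHypothesis.ValiantsHypothesis.Theorems.LacunarySymmetroidMatrixDescartesFiniteSectorSectorCeilingTwoTen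
import Summits.ValiantsHypothesis.ValiantsHypothesis.Theorems.LacunarySymmetroidMatrixDescartesFiniteSectorStampCeilingEighteenFive
import Summits.ValiantsHypothesis.ValiantsHypothesis.Theorems.LacunarySymmetroidMatrixDescartesFiniteSectorStampCeilingFiveSeven
import Summits.ValiantsHypothesis.ValiantsHypothesis.Theorems.LacunarySymmetroidMatrixDescartesFiniteSectorStampCeilingFortyFour
import Summits.ValiantsHypothesis.ValiantsHypothesis.Theorems.LacunarySymmetroidMatrixDescartesFiniteSectorStampCeilingFourEight
import Summits.ValiantsHypothesis.ValiantsHypothesis.Theorems.LacunarySymmetroidMatrixDescartesFiniteSectorStampCeilingFourSeven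
import Summits.ValiantsHypothesis.ValiantsHypothesis.Theorems.LacunarySymmetroidMatrixDescartesFiniteSectorStampCeilingMTwoEleven
import Summits.ValiantsHypothesis.ValiantsHypothesis.Theorems.LacunarySymmetroidMatrixDescartesFiniteSectorStampCeilingMTwoHigh
import Summits.ValiantsHypothesis.ValiantsHypothesis.Theorems.LacunarySymmetroidMatrixDescartesFiniteSectorStampCeilingMTwoNine
import Summits.ValiantsHypothesis.ValiantsHypothesis.Theorems.LacunarySymmetroidMatrixDescartesFiniteSectorStampCeilingMTwoTen
import Summits.ValiantsHypothesis.ValiantsHypothesis.Theorems.LacunarySymmetroidMatrixDescartesFiniteSectorStampCeilingNineSix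
import Summits.ValiantsHypothesis.ValiantsHypothesis.Theorems.LacunarySymmetroidMatrixDescartesFiniteSectorStampCeilingNineteenFive
import Summits.ValiantsHypothesis.ValiantsHypothesis.Theorems.LacunarySymmetroidMatrixDescartesFiniteSectorStampCeilingSeventeenFive
import Summits.ValiantsHypothesis.ValiantsHypothesis.Theorems.LacunarySymmetroidMatrixDescartesFiniteSectorStampCeilingSixteenFive
import Summits.ValiantsHypothesis.ValiantsHypothesis.Theorems.LacunarySymmetroidMatrixDescartesFiniteSectorStampCeilingThirtyFour
import Summits.ValiantsHypothesis.ValiantsHypothesis.Theorems.LacunarySymmetroidMatrixDescartesFiniteSectorStampCeilingThirtyeightFour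
import Summits.ValiantsHypothesis.ValiantsHypothesis.Theorems.LacunarySymmetroidMatrixDescartesFiniteSectorStampCeilingThirtyfiveFour
import Summits.ValiantsHypothesis.ValiantsHypothesis.Theorems.LacunarySymmetroidMatrixDescartesFiniteSectorStampCeilingThirtyfourFour
import Summits.ValiantsHypothesis.ValiantsHypothesis.Theorems.LacunarySymmetroidMatrixDescartesFiniteSectorStampCeilingThirtynineFour
import Summits.ValiantsHypothesis.ValiantsHypothesis.Theorems.LacunarySymmetroidMatrixDescartesFiniteSectorStampCeilingThirtyoneFour
import Summits.ValiantsHypothesis.ValiantsHypothesis.Theorems.LacunarySymmetroidMatrixDescartesFiniteSectorStampCeilingThirtysevenFour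
import Summits.ValiantsHypothesis.ValiantsHypothesis.Theorems.LacunarySymmetroidMatrixDescartesFiniteSectorStampCeilingThirtysixFour
import Summits.ValiantsHypothesis.ValiantsHypothesis.Theorems.LacunarySymmetroidMatrixDescartesFiniteSectorStampCeilingThirtythreeFour
import Summits.ValiantsHypothesis.ValiantsHypothesis.Theorems.LacunarySymmetroidMatrixDescartesFiniteSectorStampCeilingThirtytwoFour
import Summits.ValiantsHypothesis.ValiantsHypothesis.Theorems.LacunarySymmetroidMatrixDescartesFiniteSectorStampCeilingThreeEight
import Summits.ValiantsHypothesis.ValiantsHypothesis.Theorems.LacunarySymmetroidMatrixDescartesFiniteSectorStampCeilingThreeNine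
import Summits.ValiantsHypothesis.ValiantsHypothesis.Theorems.LacunarySymmetroidMatrixDescartesFiniteSectorStampCeilingThreeSeven
import Summits.ValiantsHypothesis.ValiantsHypothesis.Theorems.LacunarySymmetroidMatrixDescartesFiniteSectorStampCeilingTwentyeightFour
import Summits.ValiantsHypothesis.ValiantsHypothesis.Theorems.LacunarySymmetroidMatrixDescartesFiniteSectorStampCeilingTwentynineFour
import Summits.ValiantsHypothesis.ValiantsHypothesis.Theorems.LacunarySymmetroidMatrixDescartesFiniteSectorStampCeilingTwentysevenFour
import Summits.ValiantsHypothesis.ValiantsHypothesis.Theorems.LacunarySymmetroidMatrixDescartesFiniteSectorStampCeilingTwentysixFour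
import Summits.ValiantsHypothesis.ValiantsHypothesis.Theorems.LacunarySymmetroidMatrixDescartesFiniteSectorStampCeilingTwoTwelve

/-!
# `MatrixDescartes` — line «finite»: the KERNEL TABLE of the finite registers, by name — successor II (columns `K = 4 … 8`, row `m = 2`)

HONEST FRAMING.  Object-search cell `pub-symmetroid`, seat val-sym-door-p5 g11.  HELPER of the crux item `stmt-ValiantsHypothesis-18050` with NO closure claim: pure by-name
bookkeeping assembling LANDED cells of line «finite» (`HypRootLawAt m K σ(m,K)` = sector ceilings, `StampLawAt m K n(m,K−1)` = stamp ceilings) into column / row theorems;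
APPEND-STYLE SUCCESSOR of `…FiniteSectorKernelTable` (val-sym-door-p5 g10, untouched; its columns stop at `m ≤ 25 / 15 / 11 / 8 / 6`), extended by this seat's cells
(K = 4 column to `m = 40`, K = 5 to `m = 19 / 14`, K = 6 to `9 / 7`, new columns K = 7, 8, row `m = 2` to `K = 12 / 10`).  Every value is an UPPER side for ALL supports;
lower sides are not claimed; RECORD-tier evidence for Conjecture Σ (`σ(m,K) = 2·n(m,K−1)`, located with 0 violations at every cell listed).  Nothing here bears on the crux
(asymptotic in `K`), on the doors, or on `VP ≠ VNP`.
[folklore] Bookkeeping over kernel-certified finite enumerations (postage-stamp numbers, Guy UPINT C12); no citation is load-bearing.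
-/

-- `Summit.ValiantsHypothesis.ValiantsHypothesis.…` repeats a component by the D-0017 layout
-- (single-conjunct summit), which the `dupNamespace` linter flags; the name is mandated.
set_option linter.dupNamespace false

namespace Summit.ValiantsHypothesis.ValiantsHypothesis.Theorems.LacunarySymmetroidMatrixDescartes.FiniteSector

/-- **The `K = 4` column, sector register, by name, extended**: `η(m,4) ≤ σ(m,4) = 2·n(m,3)` for every `2 ≤ m ≤ 40`. [folklore] -/
theorem hypRootLawAt_column_four' (m : ℕ) (hm : 2 ≤ m) (hM : m ≤ 40) :
    HypRootLawAt m 4 (([16, 30, 52, 70, 104, 138, 178, 224, 292, 344, 424, 518, 604, 708, 836, 952, 1096, 1266, 1428, 1610, 1804, 2024, 2254, 2508, 2764, 3048, 3356, 3682, 4020, 4376, 4764, 5168, 5602, 6040, 6512, 7016, 7544, 8086, 8652] : List ℕ).getD (m - 2) 0) := by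
  interval_cases m
  · exact hypRootLawAt_two_four_16
  · exact hypRootLawAt_three_four_30
  · exact hypRootLawAt_four_four_52
  · exact hypRootLawAt_five_four_70
  · exact hypRootLawAt_six_four_104
  · exact hypRootLawAt_seven_four_138
  · exact hypRootLawAt_eight_four_178
  · exact hypRootLawAt_nine_four_224
  · exact hypRootLawAt_ten_four_292
  · exact hypRootLawAt_eleven_four_344
  · exact hypRootLawAt_twelve_four_424
  · exact hypRootLawAt_thirteen_four_518
  · exact hypRootLawAt_fourteen_four_604
  · exact hypRootLawAt_fifteen_four_708
  · exact hypRootLawAt_sixteen_four_836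
  · exact hypRootLawAt_seventeen_four_952
  · exact hypRootLawAt_eighteen_four_1096
  · exact hypRootLawAt_nineteen_four_1266
  · exact hypRootLawAt_twenty_four_1428
  · exact hypRootLawAt_twentyone_four_1610
  · exact hypRootLawAt_twentytwo_four_1804
  · exact hypRootLawAt_twentythree_four_2024
  · exact hypRootLawAt_twentyfour_four_2254
  · exact hypRootLawAt_twentyfive_four_2508
  · exact hypRootLawAt_twentysix_four_2764
  · exact hypRootLawAt_twentyseven_four_3048
  · exact hypRootLawAt_twentyeight_four_3356
  · exact hypRootLawAt_twentynine_four_3682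
  · exact hypRootLawAt_thirty_four_4020
  · exact hypRootLawAt_thirtyone_four_4376
  · exact hypRootLawAt_thirtytwo_four_4764
  · exact hypRootLawAt_thirtythree_four_5168
  · exact hypRootLawAt_thirtyfour_four_5602
  · exact hypRootLawAt_thirtyfive_four_6040
  · exact hypRootLawAt_thirtysix_four_6512
  · exact hypRootLawAt_thirtyseven_four_7016
  · exact hypRootLawAt_thirtyeight_four_7544
  · exact hypRootLawAt_thirtynine_four_8086
  · exact hypRootLawAt_forty_four_8652

/-- **The `K = 4` column, stamp register, by name, extended**: `ν(m,4) ≤ n(m,3)` for every `2 ≤ m ≤ 40` (three-denomination postage-stamp numbers). [folklore] -/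
theorem stampLawAt_column_four' (m : ℕ) (hm : 2 ≤ m) (hM : m ≤ 40) :
    StampLawAt m 4 (([8, 15, 26, 35, 52, 69, 89, 112, 146, 172, 212, 259, 302, 354, 418, 476, 548, 633, 714, 805, 902, 1012, 1127, 1254, 1382, 1524, 1678, 1841, 2010, 2188, 2382, 2584, 2801, 3020, 3256, 3508, 3772, 4043, 4326] : List ℕ).getD (m - 2) 0) := by
  interval_cases m
  · exact stampLawAt_two_four
  · exact stampLawAt_three_four
  · exact stampLawAt_four_four
  · exact stampLawAt_five_four
  · exact stampLawAt_six_four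
  · exact stampLawAt_seven_four
  · exact stampLawAt_eight_four
  · exact stampLawAt_nine_four
  · exact stampLawAt_ten_four
  · exact stampLawAt_eleven_four
  · exact stampLawAt_twelve_four
  · exact stampLawAt_thirteen_four
  · exact stampLawAt_fourteen_four
  · exact stampLawAt_fifteen_four
  · exact stampLawAt_sixteen_four
  · exact stampLawAt_seventeen_four
  · exact stampLawAt_eighteen_four
  · exact stampLawAt_nineteen_four
  · exact stampLawAt_twenty_four
  · exact stampLawAt_twentyone_four
  · exact stampLawAt_twentytwo_four
  · exact stampLawAt_twentythree_four
  · exact stampLawAt_twentyfour_four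
  · exact stampLawAt_twentyfive_four
  · exact stampLawAt_twentysix_four
  · exact stampLawAt_twentyseven_four
  · exact stampLawAt_twentyeight_four
  · exact stampLawAt_twentynine_four
  · exact stampLawAt_thirty_four
  · exact stampLawAt_thirtyone_four
  · exact stampLawAt_thirtytwo_four
  · exact stampLawAt_thirtythree_four
  · exact stampLawAt_thirtyfour_four
  · exact stampLawAt_thirtyfive_four
  · exact stampLawAt_thirtysix_four
  · exact stampLawAt_thirtyseven_four
  · exact stampLawAt_thirtyeight_four
  · exact stampLawAt_thirtynine_four
  · exact stampLawAt_forty_four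

/-- **The `K = 5` column, sector register, extended**: `η(m,5) ≤ 2·n(m,4)` for `2 ≤ m ≤ 14`. [folklore] -/
theorem hypRootLawAt_column_five' (m : ℕ) (hm : 2 ≤ m) (hM : m ≤ 14) :
    HypRootLawAt m 5 (([24, 48, 88, 142, 228, 330, 468, 652, 854, 1094, 1416, 1746, 2188] : List ℕ).getD (m - 2) 0) := by
  interval_cases m
  · exact hypRootLawAt_two_five_24
  · exact hypRootLawAt_three_five_48
  · exact hypRootLawAt_four_five_88
  · exact hypRootLawAt_five_five_142
  · exact hypRootLawAt_six_five_228
  · exact hypRootLawAt_seven_five_330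
  · exact hypRootLawAt_eight_five_468
  · exact hypRootLawAt_nine_five_652
  · exact hypRootLawAt_ten_five_854
  · exact hypRootLawAt_eleven_five_1094
  · exact hypRootLawAt_twelve_five_1416
  · exact hypRootLawAt_thirteen_five_1746
  · exact hypRootLawAt_fourteen_five_2188

/-- **The `K = 5` column, stamp register, extended**: `ν(m,5) ≤ n(m,4)` for `2 ≤ m ≤ 19`. [folklore] -/
theorem stampLawAt_column_five' (m : ℕ) (hm : 2 ≤ m) (hM : m ≤ 19) :
    StampLawAt m 5 (([12, 24, 44, 71, 114, 165, 234, 326, 427, 547, 708, 873, 1094, 1383, 1650, 1935, 2304, 2782] : List ℕ).getD (m - 2) 0) := by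
  interval_cases m
  · exact stampLawAt_two_five
  · exact stampLawAt_three_five
  · exact stampLawAt_four_five
  · exact stampLawAt_five_five
  · exact stampLawAt_six_five
  · exact stampLawAt_seven_five
  · exact stampLawAt_eight_five
  · exact stampLawAt_nine_five
  · exact stampLawAt_ten_five
  · exact stampLawAt_eleven_five
  · exact stampLawAt_twelve_five
  · exact stampLawAt_thirteen_five
  · exact stampLawAt_fourteen_five
  · exact stampLawAt_fifteen_five
  · exact stampLawAt_sixteen_five
  · exact stampLawAt_seventeen_five
  · exact stampLawAt_eighteen_five
  · exact stampLawAt_nineteen_five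

/-- **The `K = 6` column, sector register, extended**: `η(m,6) ≤ 2·n(m,5)` for `2 ≤ m ≤ 7`. [folklore] -/
theorem hypRootLawAt_column_six' (m : ℕ) (hm : 2 ≤ m) (hM : m ≤ 7) :
    HypRootLawAt m 6 (([32, 72, 140, 252, 432, 690] : List ℕ).getD (m - 2) 0) := by
  interval_cases m
  · exact hypRootLawAt_two_six_32
  · exact hypRootLawAt_three_six_72
  · exact hypRootLawAt_four_six_140
  · exact hypRootLawAt_five_six_252
  · exact hypRootLawAt_six_six_432
  · exact hypRootLawAt_seven_six_690

/-- **The `K = 6` column, stamp register, extended**: `ν(m,6) ≤ n(m,5)` for `2 ≤ m ≤ 9`. [folklore] -/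
theorem stampLawAt_column_six' (m : ℕ) (hm : 2 ≤ m) (hM : m ≤ 9) :
    StampLawAt m 6 (([16, 36, 70, 126, 216, 345, 512, 797] : List ℕ).getD (m - 2) 0) := by
  interval_cases m
  · exact stampLawAt_two_six
  · exact stampLawAt_three_six
  · exact stampLawAt_four_six
  · exact stampLawAt_five_six
  · exact stampLawAt_six_six
  · exact stampLawAt_seven_six
  · exact stampLawAt_eight_six
  · exact stampLawAt_nine_six

/-- **The `K = 7` column, sector register**: `η(m,7) ≤ 2·n(m,6)` for `2 ≤ m ≤ 4`. [folklore] -/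
theorem hypRootLawAt_column_seven (m : ℕ) (hm : 2 ≤ m) (hM : m ≤ 4) :
    HypRootLawAt m 7 (([40, 104, 216] : List ℕ).getD (m - 2) 0) := by
  interval_cases m
  · exact hypRootLawAt_two_seven_40
  · exact hypRootLawAt_three_seven_104
  · exact hypRootLawAt_four_seven_216

/-- **The `K = 7` column, stamp register**: `ν(m,7) ≤ n(m,6)` for `2 ≤ m ≤ 5`. [folklore] -/
theorem stampLawAt_column_seven (m : ℕ) (hm : 2 ≤ m) (hM : m ≤ 5) :
    StampLawAt m 7 (([20, 52, 108, 211] : List ℕ).getD (m - 2) 0) := by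
  interval_cases m
  · exact stampLawAt_two_seven
  · exact stampLawAt_three_seven
  · exact stampLawAt_four_seven
  · exact stampLawAt_five_seven

/-- **The `K = 8` column, sector register**: `η(m,8) ≤ 2·n(m,7)` for `2 ≤ m ≤ 3`. [folklore] -/
theorem hypRootLawAt_column_eight (m : ℕ) (hm : 2 ≤ m) (hM : m ≤ 3) :
    HypRootLawAt m 8 (([52, 140] : List ℕ).getD (m - 2) 0) := by
  interval_cases m
  · exact hypRootLawAt_two_eight_52
  · exact hypRootLawAt_three_eight_140

/-- **The `K = 8` column, stamp register**: `ν(m,8) ≤ n(m,7)` for `2 ≤ m ≤ 4`. [folklore] -/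
theorem stampLawAt_column_eight (m : ℕ) (hm : 2 ≤ m) (hM : m ≤ 4) :
    StampLawAt m 8 (([26, 70, 162] : List ℕ).getD (m - 2) 0) := by
  interval_cases m
  · exact stampLawAt_two_eight
  · exact stampLawAt_three_eight
  · exact stampLawAt_four_eight

/-- **The `m = 2` row, sector register, extended**: `η(2,K) ≤ 2·n(2,K−1)` for `3 ≤ K ≤ 10`. [folklore] -/
theorem hypRootLawAt_row_two' (K : ℕ) (hK : 3 ≤ K) (hKM : K ≤ 10) :
    HypRootLawAt 2 K (([8, 16, 24, 32, 40, 52, 64, 80] : List ℕ).getD (K - 3) 0) := by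
  interval_cases K
  · exact hypRootLawAt_two_three_8
  · exact hypRootLawAt_two_four_16
  · exact hypRootLawAt_two_five_24
  · exact hypRootLawAt_two_six_32
  · exact hypRootLawAt_two_seven_40
  · exact hypRootLawAt_two_eight_52
  · exact hypRootLawAt_two_nine_64
  · exact hypRootLawAt_two_ten_80

/-- **The `m = 2` row, stamp register, extended**: `ν(2,K) ≤ n(2,K−1)` for `3 ≤ K ≤ 12` (OEIS A001212). [folklore] -/
theorem stampLawAt_row_two' (K : ℕ) (hK : 3 ≤ K) (hKM : K ≤ 12) :
    StampLawAt 2 K (([4, 8, 12, 16, 20, 26, 32, 40, 46, 54] : List ℕ).getD (K - 3) 0) := by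
  interval_cases K
  · exact stampLawAt_two_three
  · exact stampLawAt_two_four
  · exact stampLawAt_two_five
  · exact stampLawAt_two_six
  · exact stampLawAt_two_seven
  · exact stampLawAt_two_eight
  · exact stampLawAt_two_nine
  · exact stampLawAt_two_ten
  · exact stampLawAt_two_eleven
  · exact stampLawAt_two_twelve

end Summit.ValiantsHypothesis.ValiantsHypothesis.Theorems.LacunarySymmetroidMatrixDescartes.FiniteSector
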